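import Literature.AnabelianGeometry.AbsoluteAnabelian.AutHolomorphicSpacesHolTypeProofs
import Literature.AnabelianGeometry.AbsoluteAnabelian.AutHolomorphicSpacesLocalProofs
import Literature.AnabelianGeometry.AbsoluteAnabelian.AutHolomorphicSpacesProofs
import HarnessLib

/-!
# [AbsTopIII] Cor. 2.3 (ii) DISCHARGED: a pre-Aut-holomorphic structure determines the Aut-holomorphic structure

PROOF-ONLY companion of `AutHolomorphicSpaces` (owner module, abc-iut L4-t2): kernel proof of the
named `Prop` fact `PreAutHolStructureExtendsUnique` — S. Mochizuki, *Topics in absolute anabelian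
geometry III*, Cor. 2.3 (ii) p.53: "every pre-Aut-holomorphic structure on `X^top` extends to a
unique Aut-holomorphic structure on `X^top`" (as typed: two Riemann-surface structures `c₁`, `c₂`
on one topological space whose Aut-holomorphic structures agree on a local structure `𝒰` have the
same Aut-holomorphic structure).

Route (the printed "(ii) follows immediately from (i)"): the identity `(X, c₁) → (X, c₂)` is a
`(𝒰,𝒰)`-local morphism, hence RC-holomorphic in both directions by Cor. 2.3 (i)
(`AutHolomorphicSpacesLocalProofs`); by `AutHolomorphicSpacesHolTypeProofs` its type (holomorphic /
anti-holomorphic) is constant on every connected open `W`, and conjugating a `c₁`-biholomorphic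
self-homeomorphism of `W` by a map of constant type gives a `c₂`-biholomorphic one
(`mdifferentiableAt_conj_homeomorph`: `anti ∘ hol ∘ anti = hol` in charts).  Hence
`Aut^hol_{c₁}(W) = Aut^hol_{c₂}(W)` for all connected opens `W`, not only those in `𝒰`.

HONEST FRAMING: our kernel check of a classical statement of a refereed paper; nothing here bears
on [IUTchIII] Cor. 3.12.  Bib key `MochizukiAbsTopIII2015`; locators = kurims manuscript pages.
-/

noncomputable section

namespace Literature.AnabelianGeometry.AbsoluteAnabelian

universe u

open _root_.TopologicalSpace _root_.Topology _root_.Set _root_.Metric _root_.Function _root_.Filter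
open scoped _root_.Manifold _root_.ContDiff ComplexConjugate

/-! ### Conjugation by a homeomorphism of constant type -/

section Conj

variable {X Y : Type u} [TopologicalSpace X] [ChartedSpace ℂ X] [IsManifold 𝓘(ℂ, ℂ) ω X]
  [TopologicalSpace Y] [ChartedSpace ℂ Y] [IsManifold 𝓘(ℂ, ℂ) ω Y]

/-- **Conjugation by an RC-holomorphic homeomorphism of constant type preserves holomorphy.**  Let
`φ : X ≃ₜ Y` be RC-holomorphic in both directions, `ψ : X → X` `ℂ`-differentiable at `p`, and suppose
`p` and `ψ p` have the same type for `φ` (both holomorphic or both anti-holomorphic points).  Then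
`φ ∘ ψ ∘ φ⁻¹` is `ℂ`-differentiable at `φ p`. [cite: MochizukiAbsTopIII2015, Corollary 2.3 (ii) p.53] -/
theorem mdifferentiableAt_conj_homeomorph (φ : X ≃ₜ Y) (hY : IsRCHolomorphic (⇑φ.symm))
    {ψ : X → X} {p : X} (hψ : MDifferentiableAt 𝓘(ℂ, ℂ) 𝓘(ℂ, ℂ) ψ p)
    (htype : (IsHolAt (⇑φ) p ∧ IsHolAt (⇑φ) (ψ p)) ∨ (IsAntiHolAt (⇑φ) p ∧ IsAntiHolAt (⇑φ) (ψ p))) :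
    MDifferentiableAt 𝓘(ℂ, ℂ) 𝓘(ℂ, ℂ) (⇑φ ∘ ψ ∘ ⇑φ.symm) (φ p) := by
  have hψc : ContinuousAt ψ p := hψ.continuousAt
  rcases htype with ⟨h1, h2⟩ | ⟨h1, h2⟩
  · -- holomorphic type at `p` and `ψ p`
    have hs : MDifferentiableAt 𝓘(ℂ, ℂ) 𝓘(ℂ, ℂ) (⇑φ.symm) (φ p) :=
      (isHolAt_symm_of_isHolAt φ h1 (hY (φ p))).self_of_nhds
    have hψ' : MDifferentiableAt 𝓘(ℂ, ℂ) 𝓘(ℂ, ℂ) ψ (φ.symm (φ p)) := by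
      rw [φ.symm_apply_apply]; exact hψ
    have hφ' : MDifferentiableAt 𝓘(ℂ, ℂ) 𝓘(ℂ, ℂ) (⇑φ) (ψ (φ.symm (φ p))) := by
      rw [φ.symm_apply_apply]; exact h2.self_of_nhds
    exact (hφ'.comp _ hψ').comp _ hs
  · -- anti-holomorphic type at `p` and `ψ p`
    have h1' : IsAntiHolAt (⇑φ.symm) (φ p) := isAntiHolAt_symm_of_isAntiHolAt φ h1 (hY (φ p))
      (by rw [Homeomorph.symm_symm, φ.symm_apply_apply]
          exact Or.inr h1)
    set a := chartAt ℂ p with ha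
    set a' := chartAt ℂ (ψ p) with ha'
    set b := chartAt ℂ (φ p) with hb
    set b' := chartAt ℂ (φ (ψ p)) with hb'
    set T₁ := writtenInExtChartAt 𝓘(ℂ, ℂ) 𝓘(ℂ, ℂ) (ψ p) (⇑φ) with hT₁
    set Ψ := writtenInExtChartAt 𝓘(ℂ, ℂ) 𝓘(ℂ, ℂ) p ψ with hΨ
    set T₂ := writtenInExtChartAt 𝓘(ℂ, ℂ) 𝓘(ℂ, ℂ) (φ p) (⇑φ.symm) with hT₂
    have hT₁def : ∀ w, T₁ w = b' (φ (a'.symm w)) := fun w => by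
      simp [hT₁, writtenInExtChartAt, ha', hb']
    have hΨdef : ∀ w, Ψ w = a' (ψ (a.symm w)) := fun w => by
      simp [hΨ, writtenInExtChartAt, ha, ha']
    have hT₂def : ∀ v, T₂ v = a (φ.symm (b.symm v)) := fun v => by
      simp [hT₂, writtenInExtChartAt, ha, hb, Homeomorph.symm_apply_apply]
    -- the three differentiability facts
    have d1 : DifferentiableAt ℂ (conj ∘ T₁) (a' (ψ p)) := by
      have h := (h2.self_of_nhds).2
      have hpt1 : extChartAt 𝓘(ℂ, ℂ) (ψ p) (ψ p) = a' (ψ p) := by simp [ha']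
      rw [hpt1] at h
      exact h
    have d2 : DifferentiableAt ℂ Ψ (a p) := by
      have h := differentiableAt_writtenInExtChartAt hψ
      have hpt2 : extChartAt 𝓘(ℂ, ℂ) p p = a p := by simp [ha]
      rw [hpt2] at h
      exact h
    have d3 : DifferentiableAt ℂ (conj ∘ T₂) (b (φ p)) := by
      have h := (h1'.self_of_nhds).2
      have hpt3 : extChartAt 𝓘(ℂ, ℂ) (φ p) (φ p) = b (φ p) := by simp [hb]
      rw [hpt3] at h
      exact h
    -- continuity of the conjugate
    have hcψ : ContinuousAt (ψ ∘ ⇑φ.symm) (φ p) :=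
      ContinuousAt.comp (by rw [φ.symm_apply_apply]; exact hψc) φ.symm.continuous.continuousAt
    have hcont : ContinuousAt (⇑φ ∘ ψ ∘ ⇑φ.symm) (φ p) := φ.continuous.continuousAt.comp hcψ
    -- the chart expression of `φ ∘ ψ ∘ φ⁻¹` at `φ p`, near the base point
    rw [mdifferentiableAt_iff]
    refine ⟨hcont, ?_⟩
    simp only [ModelWithCorners.Boundaryless.range_eq_univ, differentiableWithinAt_univ]
    have hpt : extChartAt 𝓘(ℂ, ℂ) (φ p) (φ p) = b (φ p) := by simp [hb]
    rw [hpt]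
    have lhs : ∀ v, writtenInExtChartAt 𝓘(ℂ, ℂ) 𝓘(ℂ, ℂ) (φ p) (⇑φ ∘ ψ ∘ ⇑φ.symm) v =
        b' (φ (ψ (φ.symm (b.symm v)))) := by
      intro v
      simp only [writtenInExtChartAt, extChartAt_coe, extChartAt_coe_symm, modelWithCornersSelf_coe,
        modelWithCornersSelf_coe_symm, comp_apply, id, Homeomorph.symm_apply_apply, hb, hb']
    have hnear : ∀ᶠ v in 𝓝 (b (φ p)),
        writtenInExtChartAt 𝓘(ℂ, ℂ) 𝓘(ℂ, ℂ) (φ p) (⇑φ ∘ ψ ∘ ⇑φ.symm) v =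
          ((conj ∘ ((conj ∘ T₁) ∘ Ψ) ∘ conj) ∘ (conj ∘ T₂)) v := by
      -- pull the chart-domain conditions back along `b.symm`
      have c1 : ∀ᶠ y in 𝓝 (φ p), φ.symm y ∈ a.source :=
        φ.symm.continuous.continuousAt.preimage_mem_nhds
          (by rw [φ.symm_apply_apply]; exact a.open_source.mem_nhds (mem_chart_source ℂ p))
      have c2 : ∀ᶠ y in 𝓝 (φ p), ψ (φ.symm y) ∈ a'.source :=
        hcψ.preimage_mem_nhds (by
          simp only [comp_apply, φ.symm_apply_apply]
          exact a'.open_source.mem_nhds (mem_chart_source ℂ (ψ p)))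
      have key : ∀ᶠ y in 𝓝 (φ p),
          writtenInExtChartAt 𝓘(ℂ, ℂ) 𝓘(ℂ, ℂ) (φ p) (⇑φ ∘ ψ ∘ ⇑φ.symm) (b y) =
            ((conj ∘ ((conj ∘ T₁) ∘ Ψ) ∘ conj) ∘ (conj ∘ T₂)) (b y) := by
        filter_upwards [c1, c2, b.open_source.mem_nhds (mem_chart_source ℂ (φ p))] with y hy1 hy2 hyb
        rw [lhs]
        simp only [comp_apply, Complex.conj_conj, hT₁def, hΨdef, hT₂def, b.left_inv hyb,
          a.left_inv hy1, a'.left_inv hy2]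
      filter_upwards [(b.eventually_nhds' _ (mem_chart_source ℂ (φ p))).2 key,
        b.eventually_right_inverse' (mem_chart_source ℂ (φ p))] with v hv hri
      rwa [hri] at hv
    refine (Filter.EventuallyEq.differentiableAt_iff hnear).2 ?_
    refine DifferentiableAt.comp _ ?_ d3
    rw [differentiableAt_conj_conj_iff]
    have hv0 : (conj ∘ T₂) (b (φ p)) = conj (a p) := by
      simp only [comp_apply, hT₂def, b.left_inv (mem_chart_source ℂ (φ p)), φ.symm_apply_apply]
    rw [hv0, Complex.conj_conj]
    refine DifferentiableAt.comp _ ?_ d2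
    have hw0 : Ψ (a p) = a' (ψ p) := by
      rw [hΨdef, a.left_inv (mem_chart_source ℂ p)]
    rw [hw0]
    exact d1

/-- **Transfer of biholomorphic automorphisms of connected opens.**  In the situation of
`mdifferentiableAt_conj_homeomorph` with `φ` RC-holomorphic in both directions: on a preconnected open
`U ⊆ X` with image `V ⊆ Y` (identified via `e`, the restriction of `φ`), conjugating a
`ℂ`-differentiable self-homeomorphism `ψ` of `U` gives a `ℂ`-differentiable self-map of `V`.
[cite: MochizukiAbsTopIII2015, Corollary 2.3 (ii) p.53] -/
theorem mdifferentiable_conj_restrict (φ : X ≃ₜ Y) (hX : IsRCHolomorphic (⇑φ))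
    (hY : IsRCHolomorphic (⇑φ.symm)) {U : Opens X} (hU : IsPreconnected (U : Set X)) {V : Opens Y}
    (e : U ≃ₜ V) (he : ∀ x : U, (e x : Y) = φ x) (ψ : U ≃ₜ U)
    (hψ : MDifferentiable 𝓘(ℂ, ℂ) 𝓘(ℂ, ℂ) ψ) :
    MDifferentiable 𝓘(ℂ, ℂ) 𝓘(ℂ, ℂ) (e.symm.trans (ψ.trans e)) := by
  intro q
  set x := e.symm q with hx
  have hq : (q : Y) = φ (x : X) := by rw [← he x, hx, e.apply_symm_apply]
  -- ambient extension of `ψ`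
  set Ψ : X → X := Function.extend Subtype.val (Subtype.val ∘ ψ) id with hΨ
  have hΨval : ∀ y : U, Ψ y = (ψ y : X) := fun y => Subtype.val_injective.extend_apply _ _ y
  have hΨd : MDifferentiableAt 𝓘(ℂ, ℂ) 𝓘(ℂ, ℂ) Ψ (x : X) :=
    (mdifferentiableAt_opens_iff (Ψ := ψ) (Φ := Ψ) (fun y => (hΨval y).symm) x).1 (hψ x)
  -- same type at `x` and `ψ x`
  have htype : (IsHolAt (⇑φ) (x : X) ∧ IsHolAt (⇑φ) (Ψ x)) ∨
      (IsAntiHolAt (⇑φ) (x : X) ∧ IsAntiHolAt (⇑φ) (Ψ x)) := by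
    rw [hΨval]
    rcases forall_isHolAt_or_forall_isAntiHolAt φ hX hU with h | h
    · exact Or.inl ⟨h _ x.2, h _ (ψ x).2⟩
    · exact Or.inr ⟨h _ x.2, h _ (ψ x).2⟩
  have key := mdifferentiableAt_conj_homeomorph φ hY hΨd htype
  rw [← hq] at key
  refine (mdifferentiableAt_opens_iff (Ψ := e.symm.trans (ψ.trans e)) (Φ := ⇑φ ∘ Ψ ∘ ⇑φ.symm)
    (fun y => ?_) q).2 key
  -- the restriction agrees with the ambient conjugate
  have hy : φ.symm (y : Y) = ((e.symm y : U) : X) := by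
    rw [Homeomorph.symm_apply_eq, ← he, e.apply_symm_apply]
  simp only [Homeomorph.trans_apply, comp_apply, he, hy, hΨval]

end Conj

/-! ### Corollary 2.3 (ii) -/

/-- **[AbsTopIII] Cor. 2.3 (ii) holds as typed** (`PreAutHolStructureExtendsUnique` DISCHARGED): two
Riemann-surface structures on the same topological space whose Aut-holomorphic structures agree on
a local structure `𝒰` have equal Aut-holomorphic structures.
[cite: MochizukiAbsTopIII2015, Corollary 2.3 (ii) p.53] -/
theorem preAutHolStructureExtendsUnique_holds : PreAutHolStructureExtendsUnique := by
  intro X _ _ c₁ c₂ m₁ m₂ 𝒰 h𝒰 hres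
  -- the identity is a `(𝒰,𝒰)`-local morphism in both directions
  have hlm : ∀ (d₁ d₂ : ChartedSpace ℂ X),
      (@AutHolStructure.ofCharted X _ d₁).restrict h𝒰 = (@AutHolStructure.ofCharted X _ d₂).restrict h𝒰 →
      IsLocalMorphism (@AutHolStructure.ofCharted X _ d₁) (@AutHolStructure.ofCharted X _ d₂) 𝒰 𝒰
        (⇑(Homeomorph.refl X)) := by
    intro d₁ d₂ hd
    refine ⟨(Homeomorph.refl X).isLocalHomeomorph, ?_⟩
    intro U V hU hV e he
    have hUV : U = V := by
      apply Subtype.ext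
      ext y
      constructor
      · intro hy
        have h1 : ((e ⟨y, hy⟩ : V.1) : X) = y := by simpa using he ⟨y, hy⟩
        rw [← h1]; exact (e ⟨y, hy⟩).2
      · intro hy
        have h1 : ((e (e.symm ⟨y, hy⟩) : V.1) : X) = ((e.symm ⟨y, hy⟩ : U.1) : X) := by
          simpa using he (e.symm ⟨y, hy⟩)
        rw [e.apply_symm_apply] at h1
        rw [show y = ((e.symm ⟨y, hy⟩ : U.1) : X) from h1]
        exact (e.symm ⟨y, hy⟩).2
    subst hUV
    have hee : e = Homeomorph.refl _ := Homeomorph.ext fun y => Subtype.ext (by simpa using he y)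
    rw [hee, homeoConj_refl, Subgroup.map_id]
    have h1 := congrArg (fun R : PreAutHolStructure X 𝒰 => R.aut ⟨U.1, hU⟩) hd
    exact h1
  have hlm₁₂ := hlm c₁ c₂ hres
  have hlm₂₁ := hlm c₂ c₁ hres.symm
  have hrc₁₂ : @IsRCHolomorphic X _ X _ c₁ c₂ (⇑(Homeomorph.refl X)) := fun p =>
    @isHolAt_or_isAntiHolAt_of_isLocalMorphism X X _ c₁ m₁ _ c₂ m₂ 𝒰 𝒰 h𝒰 h𝒰 _ hlm₁₂ p
  have hrc₂₁ : @IsRCHolomorphic X _ X _ c₂ c₁ (⇑(Homeomorph.refl X)) := fun p =>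
    @isHolAt_or_isAntiHolAt_of_isLocalMorphism X X _ c₂ m₂ _ c₁ m₁ 𝒰 𝒰 h𝒰 h𝒰 _ hlm₂₁ p
  -- transfer of `Aut^hol(W)` for every connected open `W`
  have htrans : ∀ (d₁ d₂ : ChartedSpace ℂ X) (n₁ : @IsManifold ℂ _ ℂ _ _ ℂ _ 𝓘(ℂ, ℂ) ω X _ d₁)
      (n₂ : @IsManifold ℂ _ ℂ _ _ ℂ _ 𝓘(ℂ, ℂ) ω X _ d₂),
      @IsRCHolomorphic X _ X _ d₁ d₂ (⇑(Homeomorph.refl X)) →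
      @IsRCHolomorphic X _ X _ d₂ d₁ (⇑(Homeomorph.refl X)) →
      ∀ W : ConnectedOpens X, @holAut X _ d₁ W.1 ≤ @holAut X _ d₂ W.1 := by
    intro d₁ d₂ n₁ n₂ h₁₂ h₂₁ W ψ hψ
    rw [@mem_holAut_iff] at hψ ⊢
    have k1 := @mdifferentiable_conj_restrict X X _ d₁ n₁ _ d₂ n₂ (Homeomorph.refl X) h₁₂
      (by simpa using h₂₁) W.1 W.2.isPreconnected W.1 (Homeomorph.refl _) (fun _ => rfl) ψ hψ.1
    have k2 := @mdifferentiable_conj_restrict X X _ d₁ n₁ _ d₂ n₂ (Homeomorph.refl X) h₁₂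
      (by simpa using h₂₁) W.1 W.2.isPreconnected W.1 (Homeomorph.refl _) (fun _ => rfl) ψ.symm hψ.2
    exact ⟨fun y => k1 y, fun y => k2 y⟩
  apply AutHolStructure.ext
  funext W
  exact le_antisymm (htrans c₁ c₂ m₁ m₂ hrc₁₂ hrc₂₁ W) (htrans c₂ c₁ m₂ m₁ hrc₂₁ hrc₁₂ W)

end Literature.AnabelianGeometry.AbsoluteAnabelian
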